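import Literature.NumberTheory.Automorphic.BrandtModule
import HarnessLib

/-!
# Multiplicativity of Brandt matrices for coprime arguments (proof)

This file discharges the named fact `brandtMatrix_mul_of_coprime` of
`Literature/NumberTheory/Automorphic/BrandtModule.lean`:

  `B(m n) = B(m) B(n)` for `gcd(m, n) = 1`,

for the Brandt matrices `B(n) = T n` of every Eichler package (indeed of every `ℤ`-order `O` in a
quaternion algebra over `ℚ`, `BrandtData.ofOrder_T_mul_of_coprime`), where
`T(n)_{ij} = #{M ⊆ I_i : M an invertible right O-ideal, [I_i : M] = n², [M] = j}`.

## The printed proof and the proof given here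

Vignéras, LNM 800, Ch. III §5 exercice 5.8 (c), p. 100 ("Loi de multiplication pour `P(A)`:
`P(A) P(B) = P(AB)` si `(A, B) = 1`") and Eichler, LNM 320 (1973), Ch. II §6 Thm. 2 (18) with its
proof (23): an integral ideal of reduced norm `n₁ n₂`, `(n₁, n₂) = 1`, factors uniquely as a
product of integral ideals of reduced norms `n₁` and `n₂`; counting the factorisations class by
class gives `B(n₁ n₂)_{ik} = ∑_j B(n₁)_{ij} B(n₂)_{jk}`. In the sub-ideal form used by
`BrandtData.ofOrder` this is the statement:

* for an invertible right `O`-ideal `M ⊆ I` with `[I : M] = (m n)²`, `gcd(m, n) = 1`, there is a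
  unique invertible right `O`-ideal `L` with `M ⊆ L ⊆ I` and `[I : L] = m²` (then `[L : M] = n²`),
  namely `L = M + m² I`.

The printed proofs obtain `L` locally (`L_p = M_p` for `p ∤ n`, `L_p = I_p` for `p ∤ m`; Eichler
orders have locally principal ideals). We give the equivalent global argument, which needs no
localisation and works for invertible ideals of any `ℤ`-order:

1. `IsInvertibleRightIdeal.sup_smul` — if `a c + b d = 1` and `c d I ⊆ M ⊆ I`, then `M + c I` is
   an invertible right `O`-ideal with the explicit inverse `d M⁻¹ + I⁻¹`:
   `(d M⁻¹ + I⁻¹)(M + c I) = d O + c d M⁻¹ I + I⁻¹ M + c O = O` (as `c d M⁻¹ I ⊆ M⁻¹ M`,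
   `I⁻¹ M ⊆ I⁻¹ I` and `c O + d O = O`), and `(M + c I)(d M⁻¹ + I⁻¹)` contains
   `d O_ℓ(M) + c O_ℓ(I) ∋ 1` and stabilises `M + c I`, hence equals `O_ℓ(M + c I)`; the right
   order is exactly `O` because `O x = (L⁻¹ L) x ⊆ L⁻¹ L = O` for `x ∈ O_r(L)`.
2. `AddSubgroup.relIndex_eq_of_coprime` — index bookkeeping in an abelian group: if
   `K ⊆ L ⊆ I`, `c I ⊆ L`, `d L ⊆ K`, `[I : K] = c d` and `gcd(c, d) = 1` then `[I : L] = c` and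
   `[L : K] = d` (every prime dividing `[I : L]` divides `c`, by Cauchy's theorem in `I / L`).
   Hence `[I : M + m² I] = m²`, and the uniqueness of the intermediate ideal
   (`eq_sup_smul_of_relIndex`).
3. Finiteness of the sets counted (`finite_subideals`, from the window finiteness
   `finite_setOf_le_and_smul_mem` of `JordanZassenhaus.lean`), and the count
   `subidealCount_mul_of_coprime`: `M ↦ (M + m² I, M)` is a bijection from the sub-ideals of `I`
   of index `(m n)²` in the class `k` onto the pairs `(L, M)`, `L ⊆ I` of index `m²`, `M ⊆ L` of
   index `n²` in the class `k`; summing over the class `j` of `L` and using that the count of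
   sub-ideals of `L` depends only on `[L] = j` (`subidealCount_units_smul`) gives
   `T(mn)_{ik} = ∑_j T(m)_{ij} T(n)_{jk}`.
4. `BrandtData.ofOrder_T_mul_of_coprime` and `brandtMatrix_mul_of_coprime_holds` (the cases
   `m = 0` or `n = 0` force the other argument to be `1`, and `T 1 = 1`).

## References

* M.-F. Vignéras, *Arithmétique des algèbres de quaternions*, LNM 800 (1980), Ch. III §5
  exercice 5.8 (c), p. 100.
* M. Eichler, *The basis problem for modular forms and the traces of the Hecke operators*,
  LNM 320 (1973), Ch. II §6 Thm. 2 (18) and (23).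
-/

noncomputable section

open scoped Pointwise Matrix

universe u

namespace Literature.NumberTheory.Automorphic

/-! ### The intermediate ideal `M + c I` and its inverse -/

section Algebra

variable {B : Type u} [Ring B]

/-- `1 ∈ O` for the right order `O` of an invertible right `O`-ideal. [folklore] -/
theorem IsInvertibleRightIdeal.one_mem {O I : Submodule ℤ B} (h : IsInvertibleRightIdeal O I) :
    (1 : B) ∈ O :=
  h.rightOrderOf_eq ▸ one_mem_rightOrderOf I

/-- `(M + c I) O = M + c I` for invertible right `O`-ideals `M, I`. [folklore] -/
theorem IsInvertibleRightIdeal.sup_smul_mul_order {O M I : Submodule ℤ B}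
    (hM : IsInvertibleRightIdeal O M) (hI : IsInvertibleRightIdeal O I) (c : ℤ) :
    (M ⊔ c • I) * O = M ⊔ c • I := by
  apply le_antisymm
  · rw [Submodule.mul_le]
    intro l hl o ho
    obtain ⟨m, hm, z, hz, rfl⟩ := Submodule.mem_sup.mp hl
    obtain ⟨i, hi, rfl⟩ := (Submodule.mem_smul_pointwise_iff_exists z c I).mp hz
    rw [add_mul, smul_mul_assoc]
    exact Submodule.mem_sup.mpr
      ⟨_, hM.mul_mem hm ho, _, Submodule.smul_mem_pointwise_smul _ c I (hI.mul_mem hi ho), rfl⟩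
  · intro l hl
    rw [← mul_one l]
    exact Submodule.mul_mem_mul hl hM.one_mem

/-- **The inverse of `M + c I`, I.** For lattices `M ⊆ I` with `M' M = O = I' I`, integers with
`a c + b d = 1` and `c d I ⊆ M`: `(d M' + I') (M + c I) = O`. [folklore] -/
theorem inv_mul_sup_smul {O M I M' I' : Submodule ℤ B} (hMI : M ≤ I)
    (hM'M : M' * M = O) (hI'I : I' * I = O)
    {a b c d : ℤ} (habcd : a * c + b * d = 1) (hcd : (c * d) • I ≤ M) :
    (d • M' ⊔ I') * (M ⊔ c • I) = O := by
  apply le_antisymm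
  · rw [Submodule.mul_le]
    intro x hx y hy
    obtain ⟨m'', hm'', i', hi', rfl⟩ := Submodule.mem_sup.mp hx
    obtain ⟨m', hm', rfl⟩ := (Submodule.mem_smul_pointwise_iff_exists m'' d M').mp hm''
    obtain ⟨m, hm, z, hz, rfl⟩ := Submodule.mem_sup.mp hy
    obtain ⟨i, hi, rfl⟩ := (Submodule.mem_smul_pointwise_iff_exists z c I).mp hz
    have h1 : d • m' * m ∈ O := by
      rw [smul_mul_assoc, ← hM'M]
      exact (M' * M).smul_mem d (Submodule.mul_mem_mul hm' hm)
    have h2 : d • m' * (c • i) ∈ O := by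
      rw [smul_mul_assoc, mul_smul_comm, smul_smul, mul_comm d c, ← mul_smul_comm, ← hM'M]
      exact Submodule.mul_mem_mul hm' (hcd (Submodule.smul_mem_pointwise_smul i (c * d) I hi))
    have h3 : i' * m ∈ O := hI'I ▸ Submodule.mul_mem_mul hi' (hMI hm)
    have h4 : i' * (c • i) ∈ O := by
      rw [mul_smul_comm, ← hI'I]
      exact (I' * I).smul_mem c (Submodule.mul_mem_mul hi' hi)
    rw [add_mul, mul_add, mul_add]
    exact add_mem (add_mem h1 h2) (add_mem h3 h4)
  · intro o ho
    have ho' : (a * c + b * d) • o = o := by rw [habcd, one_smul]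
    rw [← ho', add_smul, mul_smul, mul_smul]
    refine add_mem (((d • M' ⊔ I') * (M ⊔ c • I)).smul_mem a ?_)
      (((d • M' ⊔ I') * (M ⊔ c • I)).smul_mem b ?_)
    · have : c • o ∈ I' * (c • I) := by
        rw [mul_smul_comm, hI'I]
        exact Submodule.smul_mem_pointwise_smul o c O ho
      exact SetLike.le_def.mp (mul_le_mul' le_sup_right le_sup_right) this
    · have : d • o ∈ (d • M') * M := by
        rw [smul_mul_assoc, hM'M]
        exact Submodule.smul_mem_pointwise_smul o d O ho
      exact SetLike.le_def.mp (mul_le_mul' le_sup_left le_sup_left) this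

/-- **The inverse of `M + c I`, II.** Under the same hypotheses, and with `M M' = O_ℓ(M)`,
`I I' = O_ℓ(I)`: `(M + c I) (d M' + I') = O_ℓ(M + c I)`. [folklore] -/
theorem IsInvertibleRightIdeal.sup_smul_mul_inv {O M I M' I' : Submodule ℤ B}
    (hM : IsInvertibleRightIdeal O M) (hI : IsInvertibleRightIdeal O I) (hMI : M ≤ I)
    (hMM' : M * M' = leftOrderOf M) (hM'M : M' * M = O)
    (hII' : I * I' = leftOrderOf I) (hI'I : I' * I = O)
    {a b c d : ℤ} (habcd : a * c + b * d = 1) (hcd : (c * d) • I ≤ M) :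
    (M ⊔ c • I) * (d • M' ⊔ I') = leftOrderOf (M ⊔ c • I) := by
  have hL'L := inv_mul_sup_smul hMI hM'M hI'I habcd hcd
  have hLO := hM.sup_smul_mul_order hI c
  apply le_antisymm
  · intro x hx y hy
    have : x * y ∈ (M ⊔ c • I) * (d • M' ⊔ I') * (M ⊔ c • I) := Submodule.mul_mem_mul hx hy
    rwa [mul_assoc, hL'L, hLO] at this
  · have h1 : (1 : B) ∈ (M ⊔ c • I) * (d • M' ⊔ I') := by
      have h1' : (a * c + b * d) • (1 : B) = 1 := by rw [habcd, one_smul]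
      rw [← h1', add_smul, mul_smul, mul_smul]
      refine add_mem (((M ⊔ c • I) * (d • M' ⊔ I')).smul_mem a ?_)
        (((M ⊔ c • I) * (d • M' ⊔ I')).smul_mem b ?_)
      · have : c • (1 : B) ∈ (c • I) * I' := by
          rw [smul_mul_assoc, hII']
          exact Submodule.smul_mem_pointwise_smul _ c _ (one_mem_leftOrderOf I)
        exact SetLike.le_def.mp (mul_le_mul' le_sup_right le_sup_right) this
      · have : d • (1 : B) ∈ M * (d • M') := by
          rw [mul_smul_comm, hMM']
          exact Submodule.smul_mem_pointwise_smul _ d _ (one_mem_leftOrderOf M)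
        exact SetLike.le_def.mp (mul_le_mul' le_sup_left le_sup_left) this
    intro x hx
    have hle : leftOrderOf (M ⊔ c • I) * ((M ⊔ c • I) * (d • M' ⊔ I')) ≤
        (M ⊔ c • I) * (d • M' ⊔ I') := by
      rw [← mul_assoc]
      refine mul_le_mul' ?_ le_rfl
      rw [Submodule.mul_le]
      exact fun z hz w hw => hz w hw
    have := Submodule.mul_mem_mul hx h1
    rw [mul_one] at this
    exact hle this

/-- **The right order of `M + c I` is `O`** under the same hypotheses
(`O x = (L⁻¹ L) x ⊆ L⁻¹ L = O` for `x ∈ O_r(L)`, `L = M + c I`). [folklore] -/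
theorem IsInvertibleRightIdeal.rightOrderOf_sup_smul {O M I M' I' : Submodule ℤ B}
    (hM : IsInvertibleRightIdeal O M) (hI : IsInvertibleRightIdeal O I) (hMI : M ≤ I)
    (hM'M : M' * M = O) (hI'I : I' * I = O)
    {a b c d : ℤ} (habcd : a * c + b * d = 1) (hcd : (c * d) • I ≤ M) :
    rightOrderOf (M ⊔ c • I) = O := by
  have hL'L := inv_mul_sup_smul hMI hM'M hI'I habcd hcd
  have hLO := hM.sup_smul_mul_order hI c
  apply le_antisymm
  · intro x hx
    have hle : (d • M' ⊔ I') * (M ⊔ c • I) ≤ O.comap (LinearMap.mulRight ℤ x) := by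
      rw [Submodule.mul_le]
      intro l' hl' l hl
      change l' * l * x ∈ O
      rw [mul_assoc, ← hL'L]
      exact Submodule.mul_mem_mul hl' (hx l hl)
    have h1 : (1 : B) ∈ (d • M' ⊔ I') * (M ⊔ c • I) := hL'L.symm ▸ hM.one_mem
    simpa using hle h1
  · intro o ho y hy
    rw [← hLO]
    exact Submodule.mul_mem_mul hy ho

/-- **The intermediate ideal is invertible.** For invertible right `O`-ideals `M ⊆ I` and
integers `a, b, c, d` with `a c + b d = 1` and `c d I ⊆ M`, the lattice `M + c I` is again an
invertible right `O`-ideal (with inverse `d M⁻¹ + I⁻¹`). This is the global form of the local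
statement "`(M + c I)_p = M_p` for `p ∤ d` and `= I_p` for `p ∤ c`" behind Eichler's unique
factorisation (LNM 320, II §6 (23)). [folklore] -/
theorem IsInvertibleRightIdeal.sup_smul {O M I : Submodule ℤ B}
    (hM : IsInvertibleRightIdeal O M) (hI : IsInvertibleRightIdeal O I) (hMI : M ≤ I)
    {a b c d : ℤ} (habcd : a * c + b * d = 1) (hcd : (c * d) • I ≤ M) :
    IsInvertibleRightIdeal O (M ⊔ c • I) := by
  obtain ⟨M', hMM', hM'M⟩ := hM.exists_inv
  obtain ⟨I', hII', hI'I⟩ := hI.exists_inv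
  refine ⟨⟨hM.isFullLattice.1.sup ?_, fun x => ?_⟩,
    hM.rightOrderOf_sup_smul hI hMI hM'M hI'I habcd hcd,
    ⟨d • M' ⊔ I', hM.sup_smul_mul_inv hI hMI hMM' hM'M hII' hI'I habcd hcd,
      inv_mul_sup_smul hMI hM'M hI'I habcd hcd⟩⟩
  · rw [Submodule.pointwise_smul_def]
    exact hI.isFullLattice.1.map _
  · obtain ⟨n, hn, hnx⟩ := hM.isFullLattice.2 x
    exact ⟨n, hn, Submodule.mem_sup_left hnx⟩

end Algebra

/-! ### Indices: `[I : M + m² I] = m²` and uniqueness of the intermediate lattice -/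

section Index

variable {G : Type*} [AddCommGroup G]

/-- If `c I ⊆ L` and `[I : L]` is finite, every prime factor of `[I : L]` divides `c`
(Cauchy's theorem in the finite abelian group `I / L`, which is killed by `c`). [folklore] -/
theorem _root_.AddSubgroup.dvd_of_prime_dvd_relIndex {L I : AddSubgroup G} {c p : ℕ}
    (hp : p.Prime) (hI : ∀ x ∈ I, c • x ∈ L) (h0 : L.relIndex I ≠ 0)
    (hdvd : p ∣ L.relIndex I) : p ∣ c := by
  haveI : Fact p.Prime := ⟨hp⟩
  haveI : Finite (I ⧸ L.addSubgroupOf I) := (AddSubgroup.fintypeOfIndexNeZero h0).finite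
  obtain ⟨q, hq⟩ := exists_prime_addOrderOf_dvd_card' (G := I ⧸ L.addSubgroupOf I) p hdvd
  obtain ⟨x, rfl⟩ := QuotientAddGroup.mk_surjective q
  rw [← hq]
  apply addOrderOf_dvd_of_nsmul_eq_zero
  rw [← QuotientAddGroup.mk_nsmul, QuotientAddGroup.eq_zero_iff, AddSubgroup.mem_addSubgroupOf,
    AddSubgroup.coe_nsmul]
  exact hI x x.2

/-- **Index bookkeeping.** In an abelian group let `K ⊆ L ⊆ I` be subgroups with `c I ⊆ L`,
`d L ⊆ K`, `[I : K] = c d ≠ 0` and `gcd(c, d) = 1`. Then `[I : L] = c` and `[L : K] = d`. [folklore] -/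
theorem _root_.AddSubgroup.relIndex_eq_of_coprime {K L I : AddSubgroup G} (hKL : K ≤ L)
    (hLI : L ≤ I) {c d : ℕ} (hcd : Nat.Coprime c d) (hI : ∀ x ∈ I, c • x ∈ L)
    (hL : ∀ x ∈ L, d • x ∈ K) (hidx : K.relIndex I = c * d) (h0 : c * d ≠ 0) :
    L.relIndex I = c ∧ K.relIndex L = d := by
  have hmul : K.relIndex L * L.relIndex I = c * d := by
    rw [AddSubgroup.relIndex_mul_relIndex K L I hKL hLI, hidx]
  have hs0 : L.relIndex I ≠ 0 := fun h => h0 (by rw [← hmul, h, mul_zero])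
  have ht0 : K.relIndex L ≠ 0 := fun h => h0 (by rw [← hmul, h, zero_mul])
  have hsd : Nat.Coprime (L.relIndex I) d := Nat.coprime_of_dvd fun p hp hps hpd => by
    have hpc : p ∣ c := AddSubgroup.dvd_of_prime_dvd_relIndex hp hI hs0 hps
    have := Nat.dvd_gcd hpc hpd
    rw [hcd.gcd_eq_one, Nat.dvd_one] at this
    exact hp.ne_one this
  have htc : Nat.Coprime (K.relIndex L) c := Nat.coprime_of_dvd fun p hp hpt hpc => by
    have hpd : p ∣ d := AddSubgroup.dvd_of_prime_dvd_relIndex hp hL ht0 hpt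
    have := Nat.dvd_gcd hpc hpd
    rw [hcd.gcd_eq_one, Nat.dvd_one] at this
    exact hp.ne_one this
  have hs : L.relIndex I ∣ c :=
    hsd.dvd_of_dvd_mul_right ⟨K.relIndex L, by rw [← hmul, mul_comm]⟩
  have ht : K.relIndex L ∣ d := htc.dvd_of_dvd_mul_left ⟨L.relIndex I, hmul.symm⟩
  obtain ⟨u, hu⟩ := hs
  obtain ⟨v, hv⟩ := ht
  have huv : u * v = 1 := by
    have h1 : K.relIndex L * L.relIndex I * (u * v) = K.relIndex L * L.relIndex I * 1 :=
      calc K.relIndex L * L.relIndex I * (u * v)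
          = (L.relIndex I * u) * (K.relIndex L * v) := by ring
        _ = c * d := by rw [← hu, ← hv]
        _ = K.relIndex L * L.relIndex I * 1 := by rw [mul_one, hmul]
    exact Nat.eq_of_mul_eq_mul_left (Nat.pos_of_ne_zero (hmul.symm ▸ h0)) h1
  obtain ⟨rfl, rfl⟩ := mul_eq_one.mp huv
  exact ⟨by rw [hu, mul_one], by rw [hv, mul_one]⟩

end Index

section Lattice

variable {B : Type u} [Ring B]

/-- `[I : M] • x ∈ M` for `x ∈ I` (lattices as `ℤ`-submodules; the integer `[I : M]` acting). [folklore] -/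
theorem zsmul_relIndex_mem {M I : Submodule ℤ B} {x : B} (hx : x ∈ I) :
    ((M.toAddSubgroup.relIndex I.toAddSubgroup : ℕ) : ℤ) • x ∈ M := by
  rw [natCast_zsmul]
  exact AddSubgroup.nsmul_relIndex_mem M.toAddSubgroup (K := I.toAddSubgroup) hx

/-- If `[I : M] = (m n)²` then `(m² n²) I ⊆ M`. [folklore] -/
theorem smul_le_of_relIndex_eq {M I : Submodule ℤ B} {m n : ℕ}
    (hidx : M.toAddSubgroup.relIndex I.toAddSubgroup = (m * n) ^ 2) :
    (((m ^ 2 : ℕ) : ℤ) * ((n ^ 2 : ℕ) : ℤ)) • I ≤ M := by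
  intro z hz
  obtain ⟨x, hx, rfl⟩ := (Submodule.mem_smul_pointwise_iff_exists z _ I).mp hz
  have : ((m ^ 2 : ℕ) : ℤ) * ((n ^ 2 : ℕ) : ℤ) = ((M.toAddSubgroup.relIndex I.toAddSubgroup : ℕ) : ℤ) := by
    rw [hidx]; push_cast; ring
  rw [this]
  exact zsmul_relIndex_mem hx

/-- **The indices of the intermediate lattice**: if `M ⊆ I` has index `(m n)²` with
`gcd(m, n) = 1`, `m n ≠ 0`, then `L = M + m² I` satisfies `[I : L] = m²` and `[L : M] = n²`. [folklore] -/
theorem relIndex_sup_smul_eq {M I : Submodule ℤ B} (hMI : M ≤ I) {m n : ℕ} (hm : m ≠ 0)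
    (hn : n ≠ 0) (hmn : Nat.Coprime m n)
    (hidx : M.toAddSubgroup.relIndex I.toAddSubgroup = (m * n) ^ 2) :
    (M ⊔ ((m ^ 2 : ℕ) : ℤ) • I).toAddSubgroup.relIndex I.toAddSubgroup = m ^ 2 ∧
      M.toAddSubgroup.relIndex (M ⊔ ((m ^ 2 : ℕ) : ℤ) • I).toAddSubgroup = n ^ 2 := by
  refine AddSubgroup.relIndex_eq_of_coprime (K := M.toAddSubgroup)
    (L := (M ⊔ ((m ^ 2 : ℕ) : ℤ) • I).toAddSubgroup) (I := I.toAddSubgroup)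
    (fun x hx => Submodule.mem_sup_left hx)
    (fun x hx => (sup_le hMI (Submodule.smul_le_self_of_tower _ I) : M ⊔ ((m ^ 2 : ℕ) : ℤ) • I ≤ I) hx)
    (hmn.pow 2 2) (fun x hx => ?_) (fun x hx => ?_) (by rw [hidx, mul_pow])
    (by positivity)
  · change (m ^ 2) • x ∈ M ⊔ ((m ^ 2 : ℕ) : ℤ) • I
    rw [← natCast_zsmul]
    exact Submodule.mem_sup_right (Submodule.smul_mem_pointwise_smul x _ I hx)
  · obtain ⟨u, hu, z, hz, rfl⟩ := Submodule.mem_sup.mp hx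
    obtain ⟨i, hi, rfl⟩ := (Submodule.mem_smul_pointwise_iff_exists z _ I).mp hz
    change (n ^ 2) • (u + ((m ^ 2 : ℕ) : ℤ) • i) ∈ M
    rw [smul_add]
    refine add_mem (M.smul_of_tower_mem _ hu) ?_
    rw [← natCast_zsmul, smul_smul, mul_comm]
    exact smul_le_of_relIndex_eq hidx (Submodule.smul_mem_pointwise_smul i _ I hi)

/-- **Uniqueness of the intermediate lattice**: with `M ⊆ M' ⊆ I`, `[I : M] = (m n)²`,
`[I : M'] = m²`, `gcd(m, n) = 1`, necessarily `M' = M + m² I`. [folklore] -/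
theorem eq_sup_smul_of_relIndex {M M' I : Submodule ℤ B} (hMM' : M ≤ M') (hM'I : M' ≤ I)
    {m n : ℕ} (hm : m ≠ 0) (hn : n ≠ 0) (hmn : Nat.Coprime m n)
    (hidx : M.toAddSubgroup.relIndex I.toAddSubgroup = (m * n) ^ 2)
    (hidx' : M'.toAddSubgroup.relIndex I.toAddSubgroup = m ^ 2) :
    M' = M ⊔ ((m ^ 2 : ℕ) : ℤ) • I := by
  have hle : M ⊔ ((m ^ 2 : ℕ) : ℤ) • I ≤ M' := by
    refine sup_le hMM' fun z hz => ?_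
    obtain ⟨x, hx, rfl⟩ := (Submodule.mem_smul_pointwise_iff_exists z _ I).mp hz
    rw [← hidx']
    exact zsmul_relIndex_mem hx
  refine le_antisymm ?_ hle
  have h1 := (relIndex_sup_smul_eq (hMM'.trans hM'I) hm hn hmn hidx).1
  have hmul := AddSubgroup.relIndex_mul_relIndex (M ⊔ ((m ^ 2 : ℕ) : ℤ) • I).toAddSubgroup
    M'.toAddSubgroup I.toAddSubgroup (fun x hx => hle hx) (fun x hx => hM'I hx)
  rw [h1, hidx'] at hmul
  have hone : (M ⊔ ((m ^ 2 : ℕ) : ℤ) • I).toAddSubgroup.relIndex M'.toAddSubgroup = 1 :=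
    Nat.eq_of_mul_eq_mul_right (by positivity) (hmul.trans (one_mul _).symm)
  exact fun x hx => (AddSubgroup.relIndex_eq_one.mp hone) hx

/-- `[I : M] = [I : M'] [M' : M] = m² n²` for `M ⊆ M' ⊆ I`. [folklore] -/
theorem relIndex_eq_mul_sq {M M' I : Submodule ℤ B} (hMM' : M ≤ M') (hM'I : M' ≤ I) {m n : ℕ}
    (hidx' : M'.toAddSubgroup.relIndex I.toAddSubgroup = m ^ 2)
    (hidx : M.toAddSubgroup.relIndex M'.toAddSubgroup = n ^ 2) :
    M.toAddSubgroup.relIndex I.toAddSubgroup = (m * n) ^ 2 := by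
  rw [← AddSubgroup.relIndex_mul_relIndex M.toAddSubgroup M'.toAddSubgroup I.toAddSubgroup
    (fun x hx => hMM' hx) (fun x hx => hM'I hx), hidx, hidx', mul_pow, mul_comm]

/-- **Finiteness of the sets counted by Brandt matrices**: an `FG` lattice `I` in a torsion-free
ring has only finitely many invertible right `O`-sub-ideals of a given nonzero index `N` (they
all lie in the finite window `N I ⊆ · ⊆ I`, `finite_setOf_le_and_smul_mem`). [folklore] -/
theorem finite_subideals [IsAddTorsionFree B] {O I : Submodule ℤ B} (hI : I.FG) {N : ℕ}
    (hN : N ≠ 0) (p : invertibleRightIdeals O → Prop) :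
    Finite {M : invertibleRightIdeals O // (M : Submodule ℤ B) ≤ I ∧
      (M : Submodule ℤ B).toAddSubgroup.relIndex I.toAddSubgroup = N ∧ p M} := by
  have hfin := finite_setOf_le_and_smul_mem I hI (n := (N : ℤ)) (by exact_mod_cast hN)
  haveI := hfin.to_subtype
  refine Finite.of_injective (fun M => (⟨(M : Submodule ℤ B), M.2.1, fun x hx => ?_⟩ :
    {P : Submodule ℤ B | P ≤ I ∧ ∀ x ∈ I, (N : ℤ) • x ∈ P})) fun M₁ M₂ h => ?_
  · have h := zsmul_relIndex_mem (M := (M : Submodule ℤ B)) (I := I) hx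
    rw [M.2.2.1] at h
    exact h
  · have h' := congrArg Subtype.val h
    dsimp only at h'
    exact Subtype.ext (Subtype.ext h')

end Lattice

/-! ### Counting: `T(mn)_{ik} = ∑_j T(m)_{ij} T(n)_{jk}` -/

section Count

variable {B : Type u} [Ring B] [IsAddTorsionFree B] {O : Submodule ℤ B}

/-- **Multiplicativity of the sub-ideal counts** (the combinatorial heart of
`B(mn) = B(m) B(n)`): for an invertible right `O`-ideal `I`, coprime `m, n ≥ 1` and a class `k`,
`#{M ⊆ I : [I:M] = (mn)², [M] = k} = ∑_j #{L ⊆ I : [I:L] = m², [L] = j} · #{M ⊆ I_j : [I_j:M] = n², [M] = k}`.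
Eichler 1973, II §6 (23); Vignéras III ex. 5.8 (c). [cite: VignerasLNM800, Ch. III §5 exercice 5.8 (c), p. 100] -/
theorem subidealCount_mul_of_coprime [Fintype (RightIdealClass O)] {I : Submodule ℤ B}
    (hI : IsInvertibleRightIdeal O I) {m n : ℕ} (hm : m ≠ 0) (hn : n ≠ 0)
    (hmn : Nat.Coprime m n) (k : RightIdealClass O) :
    subidealCount O I (m * n) k =
      ∑ j, subidealCount O I m j * subidealCount O (RightIdealClass.rep j) n k := by
  classical
  -- Bezout coefficients for `m², n²`
  obtain ⟨a, b, hab⟩ : IsCoprime ((m ^ 2 : ℕ) : ℤ) ((n ^ 2 : ℕ) : ℤ) :=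
    Nat.isCoprime_iff_coprime.mpr (hmn.pow 2 2)
  -- the intermediate ideals `L ⊆ I` of index `m²` form a finite type `A`
  haveI finA : Finite {L : invertibleRightIdeals O // (L : Submodule ℤ B) ≤ I ∧
      (L : Submodule ℤ B).toAddSubgroup.relIndex I.toAddSubgroup = m ^ 2 ∧ True} :=
    finite_subideals hI.isFullLattice.1 (by positivity) _
  letI := Fintype.ofFinite {L : invertibleRightIdeals O // (L : Submodule ℤ B) ≤ I ∧
      (L : Submodule ℤ B).toAddSubgroup.relIndex I.toAddSubgroup = m ^ 2 ∧ True}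
  -- each fibre is finite
  haveI finC : ∀ L : {L : invertibleRightIdeals O // (L : Submodule ℤ B) ≤ I ∧
      (L : Submodule ℤ B).toAddSubgroup.relIndex I.toAddSubgroup = m ^ 2 ∧ True},
      Finite {M : invertibleRightIdeals O // (M : Submodule ℤ B) ≤ L.1 ∧
        (M : Submodule ℤ B).toAddSubgroup.relIndex (L.1 : Submodule ℤ B).toAddSubgroup = n ^ 2 ∧
          RightIdealClass.mk M = k} :=
    fun L => finite_subideals L.1.2.isFullLattice.1 (by positivity) _
  -- Step 1: the bijection `M ↦ (M + m² I, M)`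
  have step1 : subidealCount O I (m * n) k =
      ∑ L : {L : invertibleRightIdeals O // (L : Submodule ℤ B) ≤ I ∧
        (L : Submodule ℤ B).toAddSubgroup.relIndex I.toAddSubgroup = m ^ 2 ∧ True},
        subidealCount O L.1 n k := by
    unfold subidealCount
    refine (Nat.card_congr ?_).trans Nat.card_sigma
    refine
      { toFun := fun M => ⟨⟨⟨(M.1 : Submodule ℤ B) ⊔ ((m ^ 2 : ℕ) : ℤ) • I,
            M.1.2.sup_smul hI M.2.1 hab (smul_le_of_relIndex_eq M.2.2.1)⟩,
            sup_le M.2.1 (Submodule.smul_le_self_of_tower _ I),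
            (relIndex_sup_smul_eq M.2.1 hm hn hmn M.2.2.1).1, trivial⟩,
          ⟨M.1, le_sup_left, (relIndex_sup_smul_eq M.2.1 hm hn hmn M.2.2.1).2, M.2.2.2⟩⟩
        invFun := fun p => ⟨p.2.1, p.2.2.1.trans p.1.2.1,
          relIndex_eq_mul_sq p.2.2.1 p.1.2.1 p.1.2.2.1 p.2.2.2.1, p.2.2.2.2⟩
        left_inv := fun M => rfl
        right_inv := fun p => ?_ }
    refine Sigma.subtype_ext (Subtype.ext (Subtype.ext ?_)) rfl
    exact (eq_sup_smul_of_relIndex p.2.2.1 p.1.2.1 hm hn hmn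
      (relIndex_eq_mul_sq p.2.2.1 p.1.2.1 p.1.2.2.1 p.2.2.2.1) p.1.2.2.1).symm
  -- Step 2: the count of sub-ideals of `L` depends only on the class of `L`
  have step2 : ∀ L : {L : invertibleRightIdeals O // (L : Submodule ℤ B) ≤ I ∧
      (L : Submodule ℤ B).toAddSubgroup.relIndex I.toAddSubgroup = m ^ 2 ∧ True},
      subidealCount O (RightIdealClass.rep (RightIdealClass.mk L.1)) n k =
        subidealCount O L.1 n k := by
    intro L
    obtain ⟨u, hu⟩ := RightIdealClass.exists_rep_mk_eq L.1
    rw [hu, subidealCount_units_smul]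
  -- Step 3: regroup the sum over `L` according to the class `j = [L]`
  calc subidealCount O I (m * n) k
      = ∑ L : {L : invertibleRightIdeals O // (L : Submodule ℤ B) ≤ I ∧
          (L : Submodule ℤ B).toAddSubgroup.relIndex I.toAddSubgroup = m ^ 2 ∧ True},
          subidealCount O L.1 n k := step1
    _ = ∑ L : {L : invertibleRightIdeals O // (L : Submodule ℤ B) ≤ I ∧
          (L : Submodule ℤ B).toAddSubgroup.relIndex I.toAddSubgroup = m ^ 2 ∧ True},
          subidealCount O (RightIdealClass.rep (RightIdealClass.mk L.1)) n k :=
        Finset.sum_congr rfl fun L _ => (step2 L).symm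
    _ = ∑ j, ∑ _L : {L : {L : invertibleRightIdeals O // (L : Submodule ℤ B) ≤ I ∧
          (L : Submodule ℤ B).toAddSubgroup.relIndex I.toAddSubgroup = m ^ 2 ∧ True} //
            RightIdealClass.mk L.1 = j}, subidealCount O (RightIdealClass.rep j) n k :=
        (Fintype.sum_fiberwise' (fun L : {L : invertibleRightIdeals O // (L : Submodule ℤ B) ≤ I ∧
          (L : Submodule ℤ B).toAddSubgroup.relIndex I.toAddSubgroup = m ^ 2 ∧ True} =>
            RightIdealClass.mk L.1) (fun j => subidealCount O (RightIdealClass.rep j) n k)).symm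
    _ = ∑ j, subidealCount O I m j * subidealCount O (RightIdealClass.rep j) n k := by
        refine Finset.sum_congr rfl fun j _ => ?_
        rw [Finset.sum_const, smul_eq_mul, Finset.card_univ, ← Nat.card_eq_fintype_card]
        congr 1
        unfold subidealCount
        refine Nat.card_congr ((Equiv.subtypeSubtypeEquivSubtypeInter
          (fun L : invertibleRightIdeals O => (L : Submodule ℤ B) ≤ I ∧
            (L : Submodule ℤ B).toAddSubgroup.relIndex I.toAddSubgroup = m ^ 2 ∧ True)
          (fun L => RightIdealClass.mk L = j)).trans (Equiv.subtypeEquivRight fun L => ?_))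
        simp only [and_true, and_assoc]

end Count

/-! ### Assembly -/

section Assembly

variable {B : Type u} [Ring B] [Algebra ℚ B] [IsQuaternionAlgebra ℚ B]

/-- **Multiplicativity of the Brandt matrices of a `ℤ`-order**: `B(m n) = B(m) B(n)` for
`gcd(m, n) = 1`, for the Brandt data `BrandtData.ofOrder O` of any `ℤ`-order `O` in a quaternion
algebra over `ℚ` (Eichler 1973, II §6 Thm. 2 (18); Vignéras III ex. 5.8 (c)). [cite: VignerasLNM800, Ch. III §5 exercice 5.8 (c), p. 100] -/
theorem BrandtData.ofOrder_T_mul_of_coprime {O : Submodule ℤ B} (hO : IsZOrder O) {m n : ℕ}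
    (hmn : Nat.Coprime m n) :
    (BrandtData.ofOrder O hO).T (m * n) =
      (BrandtData.ofOrder O hO).T m * (BrandtData.ofOrder O hO).T n := by
  haveI : IsAddTorsionFree B := isAddTorsionFree_of_charZero_module ℚ B
  rcases Nat.eq_zero_or_pos m with rfl | hm
  · obtain rfl : n = 1 := by simpa using hmn
    rw [mul_one, BrandtData.ofOrder_T_one, mul_one]
  rcases Nat.eq_zero_or_pos n with rfl | hn
  · obtain rfl : m = 1 := by simpa using hmn
    rw [one_mul, BrandtData.ofOrder_T_one, one_mul]
  ext i k
  rw [Matrix.mul_apply]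
  simp only [BrandtData.ofOrder_T]
  have key := @subidealCount_mul_of_coprime B _ _ O (BrandtData.ofOrder O hO).instFintype _
    (RightIdealClass.isInvertibleRightIdeal_rep i) m n hm.ne' hn.ne' hmn k
  exact_mod_cast key

/-- **Discharge of the named fact `brandtMatrix_mul_of_coprime`**: the Brandt matrices of every
Eichler package satisfy `B(m n) = B(m) B(n)` for `gcd(m, n) = 1` (Vignéras, LNM 800, Ch. III
§5 exercice 5.8 (c), p. 100; Eichler, LNM 320, Ch. II §6 Thm. 2 (18)). [cite: VignerasLNM800, Ch. III §5 exercice 5.8 (c), p. 100] -/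
theorem brandtMatrix_mul_of_coprime_holds : brandtMatrix_mul_of_coprime :=
  fun _ _ P _ _ hmn => BrandtData.ofOrder_T_mul_of_coprime P.isEichlerOrder.isZOrder hmn

end Assembly

end Literature.NumberTheory.Automorphic
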